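import Literature.MathematicalPhysics.QuantumLattice.PairWordDysonSeries
import Literature.MathematicalPhysics.QuantumLattice.DWaveSourceDysonSeries
import Literature.MathematicalPhysics.QuantumLattice.HubbardHighTemperatureTwoPoint
import HarnessLib

/-!
# The `d`-wave–sourced Hubbard torus as a pair-word perturbation of the free Nambu gas

Topic `MathematicalPhysics/QuantumLattice`; the model-specific input of the word expansion
(`PairWordDysonSeries` … `PairWordSingleScalePressure`) for the route ThermalWedge. After the
Shiba/Lieb partial particle–hole transformation the sourced interacting torus is
`dΓ(𝓗_{L,μ,h}) + U(N_↑ - Σ_x n_{x↑}n_{x↓})` up to the constant `-μL²`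
(`DWaveSourceParticleHole.partitionFn_dWaveSourceTorus_eq`). Here BOTH couplings are moved out of
the one-body operator: with the source-free, interaction-free Nambu matrix
`𝓚₀ = shibaOneBody τ_L Δ_{L,0} μ 0` as the free part,

`dΓ(𝓗_{L,μ,h}) + U(N_↑ - Σ_x n_{x↑}n_{x↓}) = dΓ(𝓚₀) + Σ_{r ∈ T × Λ_L} v_r(U,h) · W_r`

(`shibaSourced_eq_dGamma_add_sum_pairWord`) with letters of two pairs each (`dwsOp`, `dwsOm`):
the Hartree letter `n_{x↑} = (c†_{x↑}c_{x↑})(c†_{x↑}c_{x↑})` (weight `U`), the on-site letter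
`n_{x↑}n_{x↓}` (weight `-U`) and, for axis `i`, sign `ς` and direction `d`, the source bond letter
`c†_{x,d} c_{x±e_i, d̄} = (c†_{x,d} c_{x±e_i,d̄})(c†_{x±e_i,d̄} c_{x±e_i,d̄})` (weight `√2 s_i h`,
`s_0 = 1`, `s_1 = -1`; the padding identity `pad_pair`). Hence
`Tr e^{-β dWaveSourceTorus L U μ h} = e^{βμL²} Tr e^{-β(dΓ(𝓚₀) + Σ_r v_r(U,h) W_r)}`
(`partitionFn_dWaveSourceTorus_eq_pairWord`): the `U`- AND `h`-dependence sits in the weights, the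
free propagator is that of two decoupled free bands — the setting in which the word expansion yields
joint analyticity in `(U, h)`. Also: the weight bound `‖v_r(U,h)‖ ≤ w` with `Σ_t w_t = 2|U| + 8√2|h|`
(`norm_dwsWeight_le`, `sum_dwsBound`), and that every orbital of a letter sits within torus distance `1`
of the letter's site (`tnorm_dwsOp_sub_le`, `tnorm_dwsOm_sub_le`; the input of the line bound).

Everything is PROVED; the definitions are the letter data (`dwsShift`, `dwsHopping`, `dwsPairing`, `dwsOp`,
`dwsOm`, `dwsWeight`, `dwsBound`); the pure source one-body matrix is `bdgNambuMatrix 0 (dwsPairing L k) 0`.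

## References
* E. H. Lieb, Phys. Rev. Lett. 62 (1989) 1201–1204, proof of Thm 2. [cite: Lieb1989, proof of Theorem 2]
* G. Benfatto, A. Giuliani, V. Mastropietro, Ann. Henri Poincaré 7 (2006) 809–898, §2.1.
  [cite: BenfattoGiulianiMastropietro2006, §2.1 (2.6)]
* H. Shiba, Prog. Theor. Phys. 48 (1972) 2171–2186, §2. [cite: Shiba1972, §2]
-/

noncomputable section

namespace Literature.MathematicalPhysics.QuantumLattice

open Matrix Finset Literature.Probability.LatticeModels
open scoped ComplexOrder

-- the generic `DecidableEq` path on `Orb (FermionTorus 2 L)` (cf. `ShibaFreeThermalKernel`)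
attribute [-instance] instDecidableEqLex

section Letters

variable (L : ℕ) [NeZero L]

/-- **Letter types of the sourced Hubbard torus**: `inl 0` = Hartree letter `n_{x↑}`, `inl 1` = on-site
letter `n_{x↑}n_{x↓}`, `inr (i, ς, d)` = source bond letter along axis `i`, sign `ς`, direction `d`.
[folklore] -/
abbrev DwsType : Type := Fin 2 ⊕ (Fin 2 × Fin 2 × Fin 2)

/-- The shifted site `x + e_i` on the torus. [folklore] -/
def dwsShift (i : Fin 2) (x : FermionTorus 2 L) : FermionTorus 2 L :=
  FermionTorus.ofTorusSite (x.toTorusSite + Pi.single i 1)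

/-- The nearest-neighbour hopping data of the torus (`-[x ∼ y]`), as in `DWaveSourceParticleHole`.
[folklore] -/
abbrev dwsHopping : FermionTorus 2 L → FermionTorus 2 L → ℂ :=
  fun x y => if (fermionTorusGraph 2 L).Adj x y then -(1 : ℂ) else 0

/-- The `d`-wave source as bond pairing data of strength `k`: `Δ_k(u, u + e_i) = -k √2 s_i` (`s_0 = 1`,
`s_1 = -1`), as in `DWaveSourceParticleHole.dWaveSourceTorus_eq_bdgBondHamiltonian_add`. [folklore] -/
abbrev dwsPairing (k : ℝ) : FermionTorus 2 L → FermionTorus 2 L → ℂ :=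
  fun u v => -(k : ℂ) * ∑ i : Fin 2,
    if v = FermionTorus.ofTorusSite (u.toTorusSite + Pi.single i 1) then
      ((Real.sqrt 2 * (if i = 0 then 1 else -1) : ℝ) : ℂ) else 0

/-- **Creation orbitals of the letters** (two pairs each): Hartree `(x↑, x↑)`; on-site `(x↑), (x↓)`; source
bond `(i, ς, d)`: `c†_{x,d}` (`ς = 0`) or `c†_{x+e_i,d}` (`ς = 1`), padded by the pair at the annihilation
orbital. [folklore] -/
def dwsOp : DwsType × FermionTorus 2 L → Fin 2 → Orb (FermionTorus 2 L)
  | (Sum.inl t, x), q => if t = 0 then orb x 0 else orb x q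
  | (Sum.inr (i, ς, d), x), q =>
      if q = 0 then (if ς = 0 then orb x d else orb (dwsShift L i x) d)
      else (if ς = 0 then orb (dwsShift L i x) d.rev else orb x d.rev)

/-- **Annihilation orbitals of the letters** (two pairs each): Hartree `x↑`; on-site `x↑, x↓`; source bond
`(i, ς, d)`: `c_{x+e_i,d̄}` (`ς = 0`) or `c_{x,d̄}` (`ς = 1`), both pairs. [folklore] -/
def dwsOm : DwsType × FermionTorus 2 L → Fin 2 → Orb (FermionTorus 2 L)
  | (Sum.inl t, x), q => if t = 0 then orb x 0 else orb x q
  | (Sum.inr (i, ς, d), x), _ => if ς = 0 then orb (dwsShift L i x) d.rev else orb x d.rev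

/-- **Weights of the letters**: `U` (Hartree), `-U` (on-site), `√2 s_i h` (source bond, `s_0 = 1`,
`s_1 = -1`). [folklore] -/
def dwsWeight (U h : ℝ) : DwsType × FermionTorus 2 L → ℂ
  | (Sum.inl t, _) => if t = 0 then (U : ℂ) else -(U : ℂ)
  | (Sum.inr (i, _, _), _) => ((Real.sqrt 2 * (if i = 0 then 1 else -1) * h : ℝ) : ℂ)

/-- The type-wise bound on the weights: `|U|` for the two interaction letters, `√2 |h|` for the eight
source letters. [folklore] -/
def dwsBound (U h : ℝ) : DwsType → ℝ
  | Sum.inl _ => |U|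
  | Sum.inr _ => Real.sqrt 2 * |h|

omit [NeZero L] in
/-- The weight bound is nonnegative. [folklore] -/
theorem dwsBound_nonneg (U h : ℝ) (t : DwsType) : 0 ≤ dwsBound U h t := by
  rcases t with t | t <;> simp only [dwsBound] <;> positivity

omit [NeZero L] in
/-- `‖v_{(t,x)}(U,h)‖ ≤ w_t`. [folklore] -/
theorem norm_dwsWeight_le (U h : ℝ) (t : DwsType) (x : FermionTorus 2 L) :
    ‖dwsWeight L U h (t, x)‖ ≤ dwsBound U h t := by
  rcases t with t | ⟨i, ς, d⟩
  · simp only [dwsWeight, dwsBound]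
    split_ifs <;> simp [Complex.norm_real]
  · simp only [dwsWeight, dwsBound, Complex.norm_real, Real.norm_eq_abs]
    rw [abs_mul, abs_mul, abs_of_nonneg (Real.sqrt_nonneg 2)]
    split_ifs <;> simp

omit [NeZero L] in
/-- `Σ_t w_t = 2|U| + 8√2|h|`. [folklore] -/
theorem sum_dwsBound (U h : ℝ) : ∑ t : DwsType, dwsBound U h t = 2 * |U| + 8 * (Real.sqrt 2 * |h|) := by
  rw [Fintype.sum_sum_type]
  simp only [dwsBound, Finset.sum_const, Finset.card_univ, Fintype.card_fin, Fintype.card_prod,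
    nsmul_eq_mul]
  push_cast
  ring

/-! ### The letters as operators -/

/-- The Hartree letter is `n_{x↑}` (padding identity). [folklore] -/
theorem pairWord_hartree (x : FermionTorus 2 L) :
    pairWord (dwsOp L) (dwsOm L) (Sum.inl 0, x) = numberOp x 0 := by
  simp only [pairWord, dwsOp, dwsOm, List.ofFn_succ, List.ofFn_zero, List.prod_cons, List.prod_nil,
    mul_one, if_true, Fin.isValue]
  rw [pad_pair]
  rfl

/-- The on-site letter is `n_{x↑}n_{x↓}`. [folklore] -/
theorem pairWord_onSite (x : FermionTorus 2 L) :
    pairWord (dwsOp L) (dwsOm L) (Sum.inl 1, x) = numberOp x 0 * numberOp x 1 := by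
  simp only [pairWord, dwsOp, dwsOm, List.ofFn_succ, List.ofFn_zero, List.prod_cons, List.prod_nil,
    mul_one, Fin.isValue, one_ne_zero, if_false, Fin.succ_zero_eq_one]
  rfl

/-- The outgoing source bond letter is `c†_{x,d} c_{x+e_i,d̄}` (padding identity). [folklore] -/
theorem pairWord_source_out (i d : Fin 2) (x : FermionTorus 2 L) :
    pairWord (dwsOp L) (dwsOm L) (Sum.inr (i, 0, d), x) =
      creation (orb x d) * annihilation (orb (dwsShift L i x) d.rev) := by
  simp only [pairWord, dwsOp, dwsOm, List.ofFn_succ, List.ofFn_zero, List.prod_cons, List.prod_nil,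
    mul_one, Fin.isValue, if_true, Fin.succ_zero_eq_one, one_ne_zero, if_false]
  rw [pad_pair]

/-- The incoming source bond letter is `c†_{x+e_i,d} c_{x,d̄}` (padding identity). [folklore] -/
theorem pairWord_source_in (i d : Fin 2) (x : FermionTorus 2 L) :
    pairWord (dwsOp L) (dwsOm L) (Sum.inr (i, 1, d), x) =
      creation (orb (dwsShift L i x) d) * annihilation (orb x d.rev) := by
  simp only [pairWord, dwsOp, dwsOm, List.ofFn_succ, List.ofFn_zero, List.prod_cons, List.prod_nil,
    mul_one, Fin.isValue, if_true, Fin.succ_zero_eq_one, one_ne_zero, if_false]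
  rw [pad_pair]

/-! ### The sites of the letters' orbitals are within distance one of the letter's site -/

omit [NeZero L] in
/-- `toTorusSite` of an orbital's site, through `ofLex`. [folklore] -/
theorem toTorusSite_fst_ofLex_orb (x : FermionTorus 2 L) (σ : Fin 2) :
    FermionTorus.toTorusSite (ofLex (orb x σ)).1 = x.toTorusSite := rfl

/-- The shifted site differs from the site by a unit vector. [folklore] -/
theorem tnorm_toTorusSite_dwsShift_sub (i : Fin 2) (x : FermionTorus 2 L) :
    Torus.tnorm ((dwsShift L i x).toTorusSite - x.toTorusSite) ≤ 1 := by
  simp only [dwsShift, FermionTorus.toTorusSite_ofTorusSite, add_sub_cancel_left]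
  exact Torus.tnorm_single_le i

/-- The creation orbital of every pair of a letter sits within torus distance `1` of the letter's site.
[folklore] -/
theorem tnorm_dwsOp_sub_le (r : DwsType × FermionTorus 2 L) (q : Fin 2) :
    Torus.tnorm (FermionTorus.toTorusSite (ofLex (dwsOp L r q)).1 - r.2.toTorusSite) ≤ 1 := by
  rcases r with ⟨t | ⟨i, ς, d⟩, x⟩
  · simp only [dwsOp]
    split_ifs <;> rw [toTorusSite_fst_ofLex_orb, sub_self, SourceGas.tnorm_zero] <;> exact zero_le_one
  · simp only [dwsOp]
    split_ifs
    · rw [toTorusSite_fst_ofLex_orb, sub_self, SourceGas.tnorm_zero]; exact zero_le_one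
    · rw [toTorusSite_fst_ofLex_orb]; exact tnorm_toTorusSite_dwsShift_sub L i x
    · rw [toTorusSite_fst_ofLex_orb]; exact tnorm_toTorusSite_dwsShift_sub L i x
    · rw [toTorusSite_fst_ofLex_orb, sub_self, SourceGas.tnorm_zero]; exact zero_le_one

/-- The annihilation orbital of every pair of a letter sits within torus distance `1` of the letter's
site. [folklore] -/
theorem tnorm_dwsOm_sub_le (r : DwsType × FermionTorus 2 L) (q : Fin 2) :
    Torus.tnorm (FermionTorus.toTorusSite (ofLex (dwsOm L r q)).1 - r.2.toTorusSite) ≤ 1 := by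
  rcases r with ⟨t | ⟨i, ς, d⟩, x⟩
  · simp only [dwsOm]
    split_ifs <;> rw [toTorusSite_fst_ofLex_orb, sub_self, SourceGas.tnorm_zero] <;> exact zero_le_one
  · simp only [dwsOm]
    split_ifs
    · rw [toTorusSite_fst_ofLex_orb]; exact tnorm_toTorusSite_dwsShift_sub L i x
    · rw [toTorusSite_fst_ofLex_orb, sub_self, SourceGas.tnorm_zero]; exact zero_le_one

end Letters

/-! ### The Hamiltonian as a pair-word perturbation of `dΓ(𝓚₀)` -/

section Identification

variable (L : ℕ) [NeZero L]

/-- The pairing data is real: `conj Δ_k(x,y) = Δ_k(x,y)`. [folklore] -/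
theorem star_dwsPairing (k : ℝ) (x y : FermionTorus 2 L) : star (dwsPairing L k x y) = dwsPairing L k x y := by
  simp only [dwsPairing, Fin.sum_univ_two, Fin.isValue, if_true, one_ne_zero, if_false, star_mul', star_neg,
    star_add, apply_ite (star : ℂ → ℂ), Complex.star_def, Complex.conj_ofReal, map_zero]

/-- The pairing data is additive in the strength. [folklore] -/
theorem dwsPairing_add (k k' : ℝ) (x y : FermionTorus 2 L) :
    dwsPairing L (k + k') x y = dwsPairing L k x y + dwsPairing L k' x y := by
  simp only [dwsPairing]
  push_cast
  ring

/-- **The Nambu matrix is affine in the source**: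
`𝓗(τ, Δ_{k+k'}, μ) = 𝓗(τ, Δ_k, μ) + 𝓗(0, Δ_{k'}, 0)`. [folklore] -/
theorem bdgNambuMatrix_dwsPairing_add (μ : ℝ) (k k' : ℝ) :
    bdgNambuMatrix (dwsHopping L) (dwsPairing L (k + k')) μ =
      bdgNambuMatrix (dwsHopping L) (dwsPairing L k) μ + bdgNambuMatrix 0 (dwsPairing L k') 0 := by
  ext o o'
  obtain ⟨x, σ⟩ := o
  obtain ⟨y, σ'⟩ := o'
  change bdgNambuMatrix _ _ μ (orb x σ) (orb y σ') =
    bdgNambuMatrix _ _ μ (orb x σ) (orb y σ') + bdgNambuMatrix 0 _ 0 (orb x σ) (orb y σ')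
  rw [bdgNambuMatrix_orb_orb, bdgNambuMatrix_orb_orb, bdgNambuMatrix_orb_orb]
  simp only [dwsPairing_add, star_add, Pi.zero_apply, Complex.ofReal_zero, ite_self]
  split_ifs <;> ring

omit [NeZero L] in
/-- The source-free, interaction-free Shiba operator is the Nambu matrix:
`shibaOneBody τ Δ μ 0 = 𝓗(τ, Δ, μ)`. [folklore] -/
theorem shibaOneBody_zero_coupling (τ Δ : FermionTorus 2 L → FermionTorus 2 L → ℂ) (μ : ℝ) :
    shibaOneBody τ Δ μ ((0 : ℝ) : ℂ) = bdgNambuMatrix τ Δ μ := by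
  rw [shibaOneBody_eq]
  ext o o'
  simp

/-- `-Δ_k(x, y) = Σ_i c_i [y = x + e_i]` with `c_i = √2 s_i k`. [folklore] -/
theorem neg_dwsPairing_eq_sum (k : ℝ) (x y : FermionTorus 2 L) :
    -dwsPairing L k x y = ∑ i : Fin 2,
      if y = dwsShift L i x then ((Real.sqrt 2 * (if i = 0 then 1 else -1) * k : ℝ) : ℂ) else 0 := by
  unfold dwsPairing dwsShift
  rw [neg_mul, neg_neg, Finset.mul_sum]
  refine Finset.sum_congr rfl fun i _ => ?_
  split_ifs <;> push_cast <;> ring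

/-- The spin blocks of the pure source Nambu matrix: only `↑↓` and `↓↑`, both with the real amplitude
`-(Δ_k(x,y) + Δ_k(y,x))`. [folklore] -/
theorem sum_spin_bdgNambuMatrix_source_smul (k : ℝ) (x y : FermionTorus 2 L) :
    ∑ σ : Fin 2, ∑ σ' : Fin 2, bdgNambuMatrix 0 (dwsPairing L k) 0 (orb x σ) (orb y σ') •
        (creation (orb x σ) * annihilation (orb y σ')) =
      (-(dwsPairing L k x y + dwsPairing L k y x)) •
        (creation (orb x 0) * annihilation (orb y 1) + creation (orb x 1) * annihilation (orb y 0)) := by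
  simp only [Fin.sum_univ_two, bdgNambuMatrix_orb_orb, Fin.isValue, if_true, one_ne_zero, if_false,
    Pi.zero_apply, Complex.ofReal_zero, ite_self, sub_zero, neg_zero, zero_add, zero_smul, add_zero,
    star_add, star_dwsPairing, smul_add]

/-- **The pure source Nambu matrix, second quantised, is the sum of the source bond letters**:
`dΓ(𝓗(0, Δ_k, 0)) = Σ_x Σ_{(i,ς,d)} (√2 s_i k) · W_{(i,ς,d),x}`. [folklore] -/
theorem dGamma_bdgNambuMatrix_source (k : ℝ) :
    dGamma (bdgNambuMatrix 0 (dwsPairing L k) 0) =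
      ∑ x : FermionTorus 2 L, ∑ t : Fin 2 × Fin 2 × Fin 2,
        ((Real.sqrt 2 * (if t.1 = 0 then 1 else -1) * k : ℝ) : ℂ) •
          pairWord (dwsOp L) (dwsOm L) (Sum.inr t, x) := by
  set c : Fin 2 → ℂ := fun i => ((Real.sqrt 2 * (if i = 0 then 1 else -1) * k : ℝ) : ℂ) with hc
  set B : FermionTorus 2 L → FermionTorus 2 L → Matrix (Finset (Orb (FermionTorus 2 L)))
      (Finset (Orb (FermionTorus 2 L))) ℂ := fun x y =>
    creation (orb x 0) * annihilation (orb y 1) + creation (orb x 1) * annihilation (orb y 0) with hB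
  have hΔ : ∀ x y : FermionTorus 2 L, -dwsPairing L k x y = ∑ i : Fin 2, if y = dwsShift L i x then c i else 0 :=
    fun x y => neg_dwsPairing_eq_sum L k x y
  -- Step 1: `dΓ = Σ_x Σ_y -(Δ(x,y) + Δ(y,x)) • B x y`
  have h1 : dGamma (bdgNambuMatrix 0 (dwsPairing L k) 0) =
      ∑ x : FermionTorus 2 L, ∑ y : FermionTorus 2 L, (-(dwsPairing L k x y + dwsPairing L k y x)) • B x y := by
    rw [dGamma_eq, sum_orb_eq_sum_sum]
    refine Finset.sum_congr rfl fun x _ => ?_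
    have hin : ∀ σ : Fin 2, ∑ o', bdgNambuMatrix 0 (dwsPairing L k) 0 (orb x σ) o' •
        (creation (orb x σ) * annihilation o') =
        ∑ y : FermionTorus 2 L, ∑ σ' : Fin 2, bdgNambuMatrix 0 (dwsPairing L k) 0 (orb x σ) (orb y σ') •
          (creation (orb x σ) * annihilation (orb y σ')) := fun σ => sum_orb_eq_sum_sum _
    simp_rw [hin]
    rw [Finset.sum_comm]
    exact Finset.sum_congr rfl fun y _ => sum_spin_bdgNambuMatrix_source_smul L k x y
  -- Step 2: split `-(Δ(x,y) + Δ(y,x))` and evaluate the bond sums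
  have h2 : ∀ x : FermionTorus 2 L, ∑ y : FermionTorus 2 L, (-dwsPairing L k x y) • B x y =
      ∑ i : Fin 2, c i • B x (dwsShift L i x) := by
    intro x
    simp_rw [hΔ, Finset.sum_smul, ite_smul, zero_smul]
    rw [Finset.sum_comm]
    refine Finset.sum_congr rfl fun i _ => ?_
    rw [Finset.sum_ite_eq' univ (dwsShift L i x) (fun y => c i • B x y), if_pos (mem_univ _)]
  have h3 : ∑ x : FermionTorus 2 L, ∑ y : FermionTorus 2 L, (-dwsPairing L k y x) • B x y =
      ∑ y : FermionTorus 2 L, ∑ i : Fin 2, c i • B (dwsShift L i y) y := by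
    rw [Finset.sum_comm]
    refine Finset.sum_congr rfl fun y _ => ?_
    simp_rw [hΔ, Finset.sum_smul, ite_smul, zero_smul]
    rw [Finset.sum_comm]
    refine Finset.sum_congr rfl fun i _ => ?_
    rw [Finset.sum_ite_eq' univ (dwsShift L i y) (fun x => c i • B x y), if_pos (mem_univ _)]
  have h4 : dGamma (bdgNambuMatrix 0 (dwsPairing L k) 0) =
      ∑ x : FermionTorus 2 L, ∑ i : Fin 2, c i • (B x (dwsShift L i x) + B (dwsShift L i x) x) := by
    rw [h1]
    simp_rw [neg_add, add_smul, Finset.sum_add_distrib]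
    rw [h3, ← Finset.sum_add_distrib]
    refine Finset.sum_congr rfl fun x _ => ?_
    rw [h2, ← Finset.sum_add_distrib]
    refine Finset.sum_congr rfl fun i _ => ?_
    simp only [hB, smul_add, add_assoc]
  -- Step 3: the letters
  rw [h4]
  refine Finset.sum_congr rfl fun x _ => ?_
  rw [Fintype.sum_prod_type]
  refine Finset.sum_congr rfl fun i _ => ?_
  simp only [Fintype.sum_prod_type, Fin.sum_univ_two, Fin.isValue, pairWord_source_out, pairWord_source_in,
    show (0 : Fin 2).rev = 1 from rfl, show (1 : Fin 2).rev = 0 from rfl, hB, hc, smul_add]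

/-- **The interaction letters**: `U(N_↑ - Σ_x n_{x↑}n_{x↓}) = Σ_x U·W_{N,x} + Σ_x (-U)·W_{D,x}`. [folklore] -/
theorem smul_hartree_sub_onSite_eq_sum_pairWord (U : ℝ) :
    (U : ℂ) • ((∑ x : FermionTorus 2 L, numberOp x 0) - ∑ x : FermionTorus 2 L, numberOp x 0 * numberOp x 1) =
      ∑ x : FermionTorus 2 L, ∑ t : Fin 2, dwsWeight L U 0 (Sum.inl t, x) • pairWord (dwsOp L) (dwsOm L) (Sum.inl t, x) := by
  simp only [Fin.sum_univ_two, Fin.isValue, pairWord_hartree, pairWord_onSite, dwsWeight, if_true, one_ne_zero,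
    if_false, Finset.sum_add_distrib, neg_smul, Finset.sum_neg_distrib]
  rw [smul_sub, Finset.smul_sum, Finset.smul_sum, sub_eq_add_neg]

omit [NeZero L] in
/-- The interaction weights do not depend on the source. [folklore] -/
theorem dwsWeight_inl (U h : ℝ) (t : Fin 2) (x : FermionTorus 2 L) :
    dwsWeight L U h (Sum.inl t, x) = dwsWeight L U 0 (Sum.inl t, x) := rfl

omit [NeZero L] in
/-- The source weights. [folklore] -/
theorem dwsWeight_inr (U h : ℝ) (t : Fin 2 × Fin 2 × Fin 2) (x : FermionTorus 2 L) :
    dwsWeight L U h (Sum.inr t, x) = ((Real.sqrt 2 * (if t.1 = 0 then 1 else -1) * h : ℝ) : ℂ) := by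
  rcases t with ⟨i, ς, d⟩
  rfl

/-- **The Shiba-transformed sourced Hubbard torus as a pair-word perturbation of the free Nambu gas**:
`dΓ(𝓗(τ_L, Δ_h, μ)) + U(N_↑ - Σ_x n_{x↑}n_{x↓}) = dΓ(shibaOneBody τ_L Δ_0 μ 0) + Σ_{r} v_r(U,h) · W_r`.
[cite: Lieb1989, proof of Theorem 2] -/
theorem shibaSourced_eq_dGamma_add_sum_pairWord (U μ h : ℝ) :
    dGamma (bdgNambuMatrix (dwsHopping L) (dwsPairing L h) μ) +
        (U : ℂ) • ((∑ x : FermionTorus 2 L, numberOp x 0) - ∑ x : FermionTorus 2 L, numberOp x 0 * numberOp x 1) =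
      dGamma (shibaOneBody (dwsHopping L) (dwsPairing L 0) μ ((0 : ℝ) : ℂ)) +
        ∑ r : DwsType × FermionTorus 2 L, dwsWeight L U h r • pairWord (dwsOp L) (dwsOm L) r := by
  rw [shibaOneBody_zero_coupling, show dwsPairing L h = dwsPairing L (0 + h) by rw [zero_add],
    bdgNambuMatrix_dwsPairing_add, dGamma_add, dGamma_bdgNambuMatrix_source,
    smul_hartree_sub_onSite_eq_sum_pairWord, Fintype.sum_prod_type, Fintype.sum_sum_type, add_assoc]
  congr 1
  rw [add_comm]
  congr 1
  · rw [Finset.sum_comm]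
    rfl
  · rw [Finset.sum_comm]
    refine Finset.sum_congr rfl fun t _ => Finset.sum_congr rfl fun x _ => ?_
    rw [dwsWeight_inr]

/-- **The sourced partition function in pair-word form**: for all real `β, U, μ, h` and `L ≥ 1`,
`Tr e^{-β dWaveSourceTorus L U μ h} = e^{βμL²} · Tr e^{-β(dΓ(𝓚₀) + 1 · Σ_r v_r(U,h) W_r)}`,
`𝓚₀ = shibaOneBody τ_L Δ_0 μ 0`. [cite: Lieb1989, proof of Theorem 2] -/
theorem partitionFn_dWaveSourceTorus_eq_pairWord (β U μ h : ℝ) :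
    partitionFn β (dWaveSourceTorus L U μ h) =
      (Real.exp (β * (μ * (L : ℝ) ^ 2)) : ℂ) *
        partitionFn β (dGamma (shibaOneBody (dwsHopping L) (dwsPairing L 0) μ ((0 : ℝ) : ℂ)) +
          (1 : ℂ) • ∑ r : DwsType × FermionTorus 2 L, dwsWeight L U h r • pairWord (dwsOp L) (dwsOm L) r) := by
  rw [one_smul, ← shibaSourced_eq_dGamma_add_sum_pairWord]
  -- the statement of `partitionFn_dWaveSourceTorus_eq` carries the `Lex` path to `DecidableEq`
  convert partitionFn_dWaveSourceTorus_eq L β U μ h using 12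

end Identification

end Literature.MathematicalPhysics.QuantumLattice
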